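import Mathlib.Analysis.Normed.Module.Alternating.Curry
import Mathlib.Topology.Algebra.Module.Alternating.Basic
import Mathlib.Data.Fin.Tuple.Basic
import Summits.Ventures.HodgeRepro2.HostAPI.Util.ForallBinderLint

noncomputable section

namespace HostAPI.Carriers.ContinuousAlternatingMap
open HostAPI.Carriers _root_.ContinuousAlternatingMap

section DomDomCongr

variable {𝕜 : Type*} [NontriviallyNormedField 𝕜] {V W : Type*} [NormedAddCommGroup V]
  [NormedSpace 𝕜 V] [NormedAddCommGroup W] [NormedSpace 𝕜 W] {ι ι' ι'' : Type*}

def domDomCongr (σ : ι ≃ ι') (f : V [⋀^ι]→L[𝕜] W) : V [⋀^ι']→L[𝕜] W :=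
  { f.toContinuousMultilinearMap.domDomCongr σ with
    map_eq_zero_of_eq' := fun v i j hv hij =>
      f.map_eq_zero_of_eq (v ∘ σ) (i := σ.symm i) (j := σ.symm j)
        (by simpa using hv) (σ.symm.injective.ne hij) }

@[simp]
theorem domDomCongr_apply (σ : ι ≃ ι') (f : V [⋀^ι]→L[𝕜] W) (v : ι' → V) :
    f.domDomCongr σ v = f (v ∘ σ) :=
  rfl

@[simp]
theorem toContinuousMultilinearMap_domDomCongr (σ : ι ≃ ι') (f : V [⋀^ι]→L[𝕜] W) :
    (f.domDomCongr σ).toContinuousMultilinearMap = f.toContinuousMultilinearMap.domDomCongr σ :=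
  rfl

@[simp]
theorem toAlternatingMap_domDomCongr (σ : ι ≃ ι') (f : V [⋀^ι]→L[𝕜] W) :
    (f.domDomCongr σ).toAlternatingMap = f.toAlternatingMap.domDomCongr σ :=
  rfl

@[simp]
theorem domDomCongr_refl (f : V [⋀^ι]→L[𝕜] W) : f.domDomCongr (Equiv.refl ι) = f :=
  rfl

theorem domDomCongr_trans (σ₁ : ι ≃ ι') (σ₂ : ι' ≃ ι'') (f : V [⋀^ι]→L[𝕜] W) :
    f.domDomCongr (σ₁.trans σ₂) = (f.domDomCongr σ₁).domDomCongr σ₂ :=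
  rfl

@[simp]
theorem domDomCongr_add (σ : ι ≃ ι') (f g : V [⋀^ι]→L[𝕜] W) :
    (f + g).domDomCongr σ = f.domDomCongr σ + g.domDomCongr σ :=
  rfl

@[simp]
theorem domDomCongr_smul (σ : ι ≃ ι') (c : 𝕜) (f : V [⋀^ι]→L[𝕜] W) :
    (c • f).domDomCongr σ = c • f.domDomCongr σ :=
  rfl

@[simp]
theorem domDomCongr_zero (σ : ι ≃ ι') : (0 : V [⋀^ι]→L[𝕜] W).domDomCongr σ = 0 :=
  rfl

end DomDomCongr

section InteriorProduct

variable {𝕜 : Type*} [NontriviallyNormedField 𝕜] {V W : Type*} [NormedAddCommGroup V]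
  [NormedSpace 𝕜 V] [NormedAddCommGroup W] [NormedSpace 𝕜 W] {m : ℕ}

def interiorProductMulti :
    (k : ℕ) → (V [⋀^Fin (m + k)]→L[𝕜] W) → (Fin k → V) → V [⋀^Fin m]→L[𝕜] W
  | 0, α, _ => α
  | k + 1, α, v => interiorProductMulti k (α.curryLeft (v 0)) (Fin.tail v)

@[simp]
theorem interiorProductMulti_zero (α : V [⋀^Fin (m + 0)]→L[𝕜] W) (v : Fin 0 → V) :
    α.interiorProductMulti 0 v = α :=
  rfl

@[simp]
theorem interiorProductMulti_succ (k : ℕ) (α : V [⋀^Fin (m + (k + 1))]→L[𝕜] W)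
    (v : Fin (k + 1) → V) :
    α.interiorProductMulti (k + 1) v = (α.curryLeft (v 0)).interiorProductMulti k (Fin.tail v) :=
  rfl

theorem interiorProductMulti_apply {k : ℕ} (α : V [⋀^Fin (m + k)]→L[𝕜] W) (v : Fin k → V)
    (w : Fin m → V) :
    α.interiorProductMulti k v w = α (Fin.append v w ∘ Fin.cast (Nat.add_comm m k)) := by
  induction k generalizing m with
  | zero =>
    simp only [interiorProductMulti]
    congr 1
    ext i
    simp [Fin.append, Fin.addCases]
  | succ k ih =>
    simp only [interiorProductMulti, ih, curryLeft_apply_apply]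
    congr 1
    ext i
    refine Fin.cases ?_ (fun j => ?_) i
    · simp [Fin.append, Fin.addCases, Matrix.vecCons]
      rfl
    · simp only [Matrix.cons_val_succ, Function.comp_apply]
      simp only [Fin.append, Fin.addCases, Fin.tail, Fin.val_cast, Fin.val_succ, eq_rec_constant]
      by_cases h : (j : ℕ) < k
      · have h' : (j : ℕ) + 1 < k + 1 := by omega
        simp only [h, h', dite_true]
        rfl
      · have h' : ¬ (j : ℕ) + 1 < k + 1 := by omega
        simp only [h, h', dite_false]
        congr 1
        ext; simp

@[simp]
theorem interiorProductMulti_add (k : ℕ) (α β : V [⋀^Fin (m + k)]→L[𝕜] W) (v : Fin k → V) :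
    (α + β).interiorProductMulti k v = α.interiorProductMulti k v + β.interiorProductMulti k v := by
  induction k generalizing m with
  | zero => rfl
  | succ k ih =>
    simp only [interiorProductMulti_succ, curryLeft_add, _root_.add_apply, ih]

@[simp]
theorem interiorProductMulti_smul (k : ℕ) (c : 𝕜) (α : V [⋀^Fin (m + k)]→L[𝕜] W)
    (v : Fin k → V) :
    (c • α).interiorProductMulti k v = c • α.interiorProductMulti k v := by
  induction k generalizing m with
  | zero => rfl
  | succ k ih =>
    simp only [interiorProductMulti_succ, curryLeft_smul, _root_.smul_apply, ih]

@[simp]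
theorem interiorProductMulti_zero_left (k : ℕ) (v : Fin k → V) :
    (0 : V [⋀^Fin (m + k)]→L[𝕜] W).interiorProductMulti k v = 0 := by
  induction k generalizing m with
  | zero => rfl
  | succ k ih => simp only [interiorProductMulti_succ, curryLeft_zero, _root_.zero_apply, ih]

end InteriorProduct

end HostAPI.Carriers.ContinuousAlternatingMap
open HostAPI.Carriers
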